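import Literature.NumberTheory.Sieve.LinearEquationsInPrimesDualFunctions
import Literature.NumberTheory.Sieve.LinearEquationsInPrimesGvNBoxes
import Literature.Combinatorics.Additive.DenseModelTheorem
import HarnessLib

/-!
# The Koopman–von Neumann decomposition relative to a pseudorandom measure (Green–Tao 2010, Prop. 10.3)

Trunk T-SIEVE (`Literature/NumberTheory/Sieve`). Part of the decomposition of
`Literature.NumberTheory.Sieve.GreenTao2010_gowersUniformity` (B. Green, T. Tao, *Linear equations
in primes*, Ann. of Math. 171 (2010), Thm. 7.2), layer "Prop. 10.1 ⇐ `GI(s)` + Prop. 10.3" (§10):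
**Proposition 10.3** ("Koopman–von Neumann theorem"; Green–Tao 2008, Prop. 8.1): a function
`|f| ≤ ν` bounded by an `(s+2)2^{s+1}`-pseudorandom measure on `ℤ_{N'}` splits as `f = f₁ + f₂` with
`|f₁| ≤ 1` and `‖f₂‖_{U^{s+1}(ℤ_{N'})} = o(1)`, and if `f` is supported on a short interval then
`f₁, f₂` may be taken supported on a slightly larger one. Everything here is proved
(`Literature.NumberTheory.Sieve.gowers_denseModel` and the taper lemmas):

* Green–Tao prove Prop. 10.3 by the energy-increment argument of Green–Tao 2008, §§7–8. We obtain
  it instead — as has been standard since Gowers and Reingold–Trevisan–Tulsiani–Vadhan — from the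
  **abstract dense model theorem** (`Literature.Combinatorics.Additive.DenseModel.denseModel_abs`,
  proved in the tree by the Hahn–Banach/Weierstrass argument) applied to the family of **dual
  functions** (Green–Tao 2008, §6; `Literature.NumberTheory.Sieve.gdual`,
  `LinearEquationsInPrimesDualFunctions.lean`), whose pseudorandomness hypothesis
  `⟨ν - 1, ∏_{i<m} φ_i⟩ = o(1)` is Green–Tao 2008, Lemma 6.3 / Prop. 6.2
  (`Literature.NumberTheory.Sieve.abs_expect_sub_one_mul_prod_gdual_le`) plus
  `‖ν - 1‖_{U^{s+1}} = o(1)` (`Literature.NumberTheory.Sieve.abs_gowersPower_sub_one_le`); the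
  family is made finite by a grid of `(ν+1)`-bounded vertex families (`gridDecode`, `gridRound`,
  `abs_gdual_sub_gdual_le`).
* **The support property.** The source multiplies `f = f₁ + f₂` by a smooth cutoff `ψ`
  (a de la Vallée Poussin kernel) and controls `‖f₂ψ‖_{U^{s+1}}` by Fourier expansion and the
  phase invariance of the (complex) Gowers norms. The tree's Gowers norms are real-valued, so we
  use instead a cutoff that is itself a dual function: the **taper**
  `ψ = (M/|A|)² 𝒟T`, `T` the vertex family `(1_I, 1_A, 1_A, 1, …, 1)`
  (`Literature.NumberTheory.Sieve.taper`), which lies in `[0,1]` (`taper_mem`), equals `1` where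
  `x + (A - A) ⊆ I` (`taper_eq_one`) and vanishes where `x + (A - A) ∩ I = ∅` (`taper_eq_zero`), with
  no Fourier analysis; and we run the dense model theorem against the test functions
  `φ_c = 𝒟G_ψ · 𝒟G_c / R₁²` (products of *two* dual functions), because then
  `‖(f - g)ψ‖_{U^k}^{2^k} = ⟨(f-g)ψ, 𝒟((f-g)ψ)⟩ = θ R₁² ⟨f - g, φ_c⟩ + O(1/L)` is small for the model `g`
  — so `g ψ` is a `1`-bounded model of `f = fψ` supported where `ψ` is (`gowers_denseModel`, stated
  for an arbitrary weight `ψ = θ 𝒟G_ψ ∈ [0,1]` with `G_ψ` `1`-bounded, `0 ≤ θ ≤ C₀`; `θ = 1`,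
  `G_ψ ≡ 1` gives the unweighted Prop. 10.3).

Quantifiers: for `k ≥ 1` (`k = s + 1`), moment constants `A`, `C₀ > 0`, `ε > 0` there is
`η₀ = η₀(k, A, C₀, ε) ∈ (0,1]` such that the conclusion `‖(f-g)ψ‖_{U^k}^{2^k} ≤ ε` holds for every
modulus `M`, every `D₀ ≥ 2^k, k+1` and every `D₀`-pseudorandom `ν` with error `η ≤ η₀` — the `o(1)` of
Prop. 10.3 made explicit, uniformly in `N'` as the source requires ("`N'` sufficiently large
depending on `ε`" ↔ `η` small).

## References

* B. Green, T. Tao, *Linear equations in primes*, Ann. of Math. (2) 171 (2010), 1753–1850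
  (arXiv:math/0606088), §10: Prop. 10.3 and its proof (the decomposition, the footnote on signed
  `f`, the cutoff `ψ` and the support property). [cite: GreenTao2010, Prop. 10.3]
* B. Green, T. Tao, *The primes contain arbitrarily long arithmetic progressions*, Ann. of Math.
  (2) 167 (2008), 481–547, Prop. 8.1 (the structure theorem), Prop. 6.2, Lemma 6.3.
  [cite: GreenTaoAnnals2008, Prop. 8.1]
* W. T. Gowers, *Decompositions, approximate structure, transference, and the Hahn–Banach
  theorem*, Bull. LMS 42 (2010), §4; O. Reingold, L. Trevisan, M. Tulsiani, S. Vadhan, *Dense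
  subsets of pseudorandom sets*, FOCS 2008 (the abstract dense model theorem used here, via
  `Literature/Combinatorics/Additive/DenseModelTheorem.lean`). [cite: Gowers2010, §4]
-/

noncomputable section

open Finset
open scoped BigOperators

namespace Literature.NumberTheory.Sieve

/-! ### Perturbation of products and of dual functions; the grid of test families -/

section grid

variable {M : ℕ} [NeZero M]

omit [NeZero M] in
/-- Perturbing the factors of a product: if `|a_i|, |b_i| ≤ c_i` and `|a_i - b_i| ≤ δ c_i` then
`|∏ a_i - ∏ b_i| ≤ |s| δ ∏ c_i`. [folklore] -/
theorem abs_prod_sub_prod_le {ι : Type*} [DecidableEq ι] (s : Finset ι) (a b c : ι → ℝ) {δ : ℝ}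
    (hδ : 0 ≤ δ) (ha : ∀ i ∈ s, |a i| ≤ c i) (hb : ∀ i ∈ s, |b i| ≤ c i)
    (hab : ∀ i ∈ s, |a i - b i| ≤ δ * c i) :
    |∏ i ∈ s, a i - ∏ i ∈ s, b i| ≤ s.card * δ * ∏ i ∈ s, c i := by
  induction s using Finset.induction_on with
  | empty => simp
  | insert j s hj ih =>
    have ha' : ∀ i ∈ s, |a i| ≤ c i := fun i hi => ha i (Finset.mem_insert_of_mem hi)
    have hb' : ∀ i ∈ s, |b i| ≤ c i := fun i hi => hb i (Finset.mem_insert_of_mem hi)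
    have hab' : ∀ i ∈ s, |a i - b i| ≤ δ * c i := fun i hi => hab i (Finset.mem_insert_of_mem hi)
    have hc0 : ∀ i ∈ s, 0 ≤ c i := fun i hi => (abs_nonneg _).trans (ha' i hi)
    have hcj : 0 ≤ c j := (abs_nonneg _).trans (ha j (Finset.mem_insert_self _ _))
    have hP : 0 ≤ ∏ i ∈ s, c i := Finset.prod_nonneg hc0
    have hPb : |∏ i ∈ s, b i| ≤ ∏ i ∈ s, c i := by
      rw [Finset.abs_prod]
      exact Finset.prod_le_prod (fun i _ => abs_nonneg _) hb'
    rw [Finset.prod_insert hj, Finset.prod_insert hj, Finset.prod_insert hj,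
      Finset.card_insert_of_notMem hj]
    have hsplit : a j * ∏ i ∈ s, a i - b j * ∏ i ∈ s, b i =
        a j * (∏ i ∈ s, a i - ∏ i ∈ s, b i) + (a j - b j) * ∏ i ∈ s, b i := by ring
    rw [hsplit]
    refine (abs_add_le _ _).trans ?_
    rw [abs_mul, abs_mul]
    have h1 : |a j| * |∏ i ∈ s, a i - ∏ i ∈ s, b i| ≤ c j * (s.card * δ * ∏ i ∈ s, c i) :=
      mul_le_mul (ha j (Finset.mem_insert_self _ _)) (ih ha' hb' hab') (abs_nonneg _) hcj
    have h2 : |a j - b j| * |∏ i ∈ s, b i| ≤ δ * c j * ∏ i ∈ s, c i :=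
      mul_le_mul (hab j (Finset.mem_insert_self _ _)) hPb (abs_nonneg _) (mul_nonneg hδ hcj)
    refine (add_le_add h1 h2).trans (le_of_eq ?_)
    push_cast
    ring

/-- Perturbing a vertex family inside its dual function: if `|G_ω|, |G'_ω| ≤ ν + 1` and
`|G_ω - G'_ω| ≤ δ (ν + 1)` pointwise, then `|𝒟G - 𝒟G'| ≤ (2^k - 1) δ 𝒟(ν + 1)` pointwise.
[folklore] -/
theorem abs_gdual_sub_gdual_le {k : ℕ} (ν : ZMod M → ℝ) (G G' : Finset (Fin k) → ZMod M → ℝ)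
    {δ : ℝ} (hδ : 0 ≤ δ) (hG : ∀ ω x, |G ω x| ≤ ν x + 1) (hG' : ∀ ω x, |G' ω x| ≤ ν x + 1)
    (hGG' : ∀ ω x, |G ω x - G' ω x| ≤ δ * (ν x + 1)) (x : ZMod M) :
    |gdual k G x - gdual k G' x| ≤ (2 ^ k - 1 : ℕ) * δ * gdual k (fun _ y => ν y + 1) x := by
  unfold gdual
  rw [← Finset.expect_sub_distrib, mul_expect]
  refine (Finset.abs_expect_le _ _).trans (Finset.expect_le_expect fun h _ => ?_)
  have hcard : ((Finset.univ : Finset (Finset (Fin k))).erase ∅).card = 2 ^ k - 1 := by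
    rw [Finset.card_erase_of_mem (Finset.mem_univ _), Finset.card_univ, Fintype.card_finset,
      Fintype.card_fin]
  have := abs_prod_sub_prod_le ((Finset.univ : Finset (Finset (Fin k))).erase ∅)
    (fun ω => G ω (x + ∑ j ∈ ω, h j)) (fun ω => G' ω (x + ∑ j ∈ ω, h j))
    (fun ω => ν (x + ∑ j ∈ ω, h j) + 1) hδ (fun ω _ => hG ω _) (fun ω _ => hG' ω _)
    (fun ω _ => hGG' ω _)
  rw [hcard] at this
  exact this

/-- The grid decoding of a family of grid indices `c : {0,1}^k × ℤ_M → {0, …, L}` relative to `ν`: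
`G_c(ω, x) = (ν(x) + 1)(2 c(ω,x)/L - 1) ∈ [-(ν + 1), ν + 1]` (a finite net of the `(ν+1)`-bounded
families, which makes the family of test functions of the dense model theorem finite).
[folklore] -/
def gridDecode {k : ℕ} (ν : ZMod M → ℝ) (L : ℕ) (c : Finset (Fin k) → ZMod M → Fin (L + 1))
    (ω : Finset (Fin k)) (x : ZMod M) : ℝ :=
  (ν x + 1) * (2 * ((c ω x : ℕ) : ℝ) / L - 1)

omit [NeZero M] in
/-- Grid families are `(ν + 1)`-bounded. [folklore] -/
theorem abs_gridDecode_le {k : ℕ} {ν : ZMod M → ℝ} (hν : ∀ x, 0 ≤ ν x) {L : ℕ} (hL : 1 ≤ L)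
    (c : Finset (Fin k) → ZMod M → Fin (L + 1)) (ω : Finset (Fin k)) (x : ZMod M) :
    |gridDecode ν L c ω x| ≤ ν x + 1 := by
  unfold gridDecode
  rw [abs_mul, abs_of_nonneg (by linarith [hν x])]
  refine mul_le_of_le_one_right (by linarith [hν x]) (abs_le.mpr ⟨?_, ?_⟩)
  · have : (0 : ℝ) ≤ 2 * ((c ω x : ℕ) : ℝ) / L := by positivity
    linarith
  · have hcL : ((c ω x : ℕ) : ℝ) ≤ L := by exact_mod_cast Nat.lt_succ_iff.mp (c ω x).isLt
    have hLpos : (0 : ℝ) < L := by exact_mod_cast hL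
    have : 2 * ((c ω x : ℕ) : ℝ) / L ≤ 2 := by
      rw [div_le_iff₀ hLpos]; linarith
    linarith

/-- Rounding a `(ν + 1)`-bounded family to the grid. [folklore] -/
def gridRound {k : ℕ} (ν : ZMod M → ℝ) (L : ℕ) (G : Finset (Fin k) → ZMod M → ℝ)
    (ω : Finset (Fin k)) (x : ZMod M) : Fin (L + 1) :=
  ⟨min L ⌊(G ω x / (ν x + 1) + 1) / 2 * L⌋₊, by omega⟩

omit [NeZero M] in
/-- The rounding error: `|G_c - G| ≤ (2/L)(ν + 1)` for `c` the rounding of a `(ν + 1)`-bounded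
family `G`. [folklore] -/
theorem abs_gridDecode_gridRound_sub_le {k : ℕ} {ν : ZMod M → ℝ} (hν : ∀ x, 0 ≤ ν x) {L : ℕ}
    (hL : 1 ≤ L) {G : Finset (Fin k) → ZMod M → ℝ} (hG : ∀ ω x, |G ω x| ≤ ν x + 1)
    (ω : Finset (Fin k)) (x : ZMod M) :
    |gridDecode ν L (gridRound ν L G) ω x - G ω x| ≤ 2 / L * (ν x + 1) := by
  have hν1 : 0 < ν x + 1 := by linarith [hν x]
  have hLpos : (0 : ℝ) < L := by exact_mod_cast hL
  set u : ℝ := (G ω x / (ν x + 1) + 1) / 2 with hu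
  have hu0 : 0 ≤ u := by
    have := (abs_le.mp (hG ω x)).1
    have : -1 ≤ G ω x / (ν x + 1) := by rw [le_div_iff₀ hν1]; linarith
    rw [hu]; linarith
  have hu1 : u ≤ 1 := by
    have := (abs_le.mp (hG ω x)).2
    have : G ω x / (ν x + 1) ≤ 1 := by rw [div_le_iff₀ hν1]; linarith
    rw [hu]; linarith
  have hfl : ⌊u * L⌋₊ ≤ L := by
    have h1 : ((⌊u * L⌋₊ : ℕ) : ℝ) ≤ u * L := Nat.floor_le (by positivity)
    have h2 : u * L ≤ L := mul_le_of_le_one_left hLpos.le hu1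
    exact_mod_cast h1.trans h2
  have hval : ((gridRound ν L G ω x : ℕ) : ℝ) = ⌊u * L⌋₊ := by
    simp only [gridRound, hu]
    rw [min_eq_right hfl]
  have herr : |((⌊u * L⌋₊ : ℕ) : ℝ) - u * L| ≤ 1 := by
    rw [abs_le]
    constructor
    · linarith [Nat.lt_floor_add_one (u * L)]
    · linarith [Nat.floor_le (show 0 ≤ u * L by positivity)]
  have hG' : G ω x = (ν x + 1) * (2 * u - 1) := by
    rw [hu]; field_simp; ring
  unfold gridDecode
  rw [hval, hG']
  have : (ν x + 1) * (2 * ((⌊u * L⌋₊ : ℕ) : ℝ) / L - 1) - (ν x + 1) * (2 * u - 1) =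
      2 / L * (ν x + 1) * (((⌊u * L⌋₊ : ℕ) : ℝ) - u * L) := by
    field_simp
    ring
  rw [this, abs_mul, abs_of_nonneg (by positivity : (0 : ℝ) ≤ 2 / L * (ν x + 1))]
  exact mul_le_of_le_one_right (by positivity) herr

end grid

section densemodel

variable {M : ℕ} [NeZero M]

/-- `dualMomentBound` is monotone in the error parameter `η ≥ -1`. [folklore] -/
theorem dualMomentBound_mono (k K : ℕ) (A : ℕ → ℝ → ℝ) {η η' : ℝ} (hη : -1 ≤ η) (h : η ≤ η') :
    dualMomentBound k K A η ≤ dualMomentBound k K A η' := by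
  unfold dualMomentBound
  have : 0 ≤ ∑ m ∈ Finset.range (2 ^ k + 1), max (A m K) 0 :=
    Finset.sum_nonneg fun m _ => le_max_right _ _
  gcongr
  linarith

/-- **The dense model theorem for the Gowers norms, with a dual-function weight** (Green–Tao 2010,
Prop. 10.3 "Koopman–von Neumann theorem" = Green–Tao 2008, Prop. 8.1, in the form obtained from the
abstract dense model theorem of Gowers and Reingold–Trevisan–Tulsiani–Vadhan): for `k ≥ 1`, moment
constants `A`, `C₀ > 0` and `ε > 0` there is `η₀ ∈ (0, 1]` such that whenever `ν : ℤ_M → ℝ⁺` is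
`D₀`-pseudorandom with error `η ≤ η₀` (`2^k, k+1 ≤ D₀`) and `ψ = θ 𝒟G_ψ ∈ [0, 1]` is a weight given by
the dual function of a `1`-bounded vertex family with `0 ≤ θ ≤ C₀`, every `f` with `|f| ≤ ν` has a
model `g : ℤ_M → [-1, 1]` with `|f - g| ≤ ν + 1` and `‖(f - g) ψ‖_{U^k(ℤ_M)}^{2^k} ≤ ε`. (With `θ = 1`
and `G_ψ ≡ 1`, `ψ ≡ 1` and this is Prop. 10.3 with `o(1)` made explicit; the weight is what gives
the support property of Prop. 10.3 without Fourier analysis, see `taper_eq_one`/`taper_eq_zero`.)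
Proof: apply `DenseModel.denseModel_abs` on `Z = ℤ_M` to the finite family of test functions
`φ_c = 𝒟G_ψ · 𝒟G_c / R₁²`, `G_c` ranging over the grid of `(ν+1)`-bounded families
(`gridDecode`), `R₁ = 2^{2^k}` (`abs_gdual_le`); its pseudorandomness hypothesis
`|⟨ν - 1, ∏_{i<m} φ_{c_i}⟩| ≤ ε'` is `abs_expect_sub_one_mul_prod_gdual_le` (Green–Tao 2008,
Lemma 6.3 with `2m` factors) together with `‖ν - 1‖_{U^k} ≤ 2η^{1/2^k}`
(`abs_gowersPower_sub_one_le`); finally `‖hψ‖_{U^k}^{2^k} = ⟨hψ, 𝒟(hψ)⟩ = θ R₁² ⟨h, φ_c⟩ + O(1/L)`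
for `h = f - g` and `c` the rounding of the constant family `hψ` (`abs_gdual_sub_gdual_le`).
[cite: GreenTao2010, Prop. 10.3] [cite: GreenTaoAnnals2008, Prop. 8.1, Prop. 6.2, Lemma 6.3] -/
theorem gowers_denseModel {k : ℕ} (hk : 1 ≤ k) (A : ℕ → ℝ → ℝ) {C₀ : ℝ} (hC₀ : 0 < C₀) {ε : ℝ}
    (hε : 0 < ε) :
    ∃ η₀ : ℝ, 0 < η₀ ∧ η₀ ≤ 1 ∧
      ∀ (M : ℕ) [NeZero M] (D₀ : ℕ), 2 ^ k ≤ D₀ → k + 1 ≤ D₀ →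
        ∀ (η : ℝ) (ν : ZMod M → ℝ), 0 ≤ η → η ≤ η₀ → IsPseudorandomMeasure D₀ η A ν →
          ∀ (Gψ : Finset (Fin k) → ZMod M → ℝ) (θ : ℝ), (∀ ω x, |Gψ ω x| ≤ 1) → 0 ≤ θ → θ ≤ C₀ →
            (∀ x, 0 ≤ θ * gdual k Gψ x) → (∀ x, θ * gdual k Gψ x ≤ 1) →
              ∀ f : ZMod M → ℝ, (∀ x, |f x| ≤ ν x) →
                ∃ g : ZMod M → ℝ, (∀ x, |g x| ≤ 1) ∧ (∀ x, |f x - g x| ≤ ν x + 1) ∧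
                  gowersPower k (fun x => (f x - g x) * (θ * gdual k Gψ x)) ≤ ε := by
  classical
  set R₁ : ℝ := 2 ^ 2 ^ k with hR₁
  have hR₁1 : 1 ≤ R₁ := one_le_pow₀ (by norm_num)
  set e : ℝ := ((2 ^ k : ℕ) : ℝ)⁻¹ with hedef
  have he0 : 0 ≤ e := by positivity
  -- constants
  set ε₁ : ℝ := ε / (2 * C₀ * R₁ ^ 2) with hε₁
  have hε₁pos : 0 < ε₁ := by positivity
  obtain ⟨K, ε', hε', HDM⟩ :=
    Literature.Combinatorics.Additive.DenseModel.denseModel_abs ε₁ hε₁pos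
  set L : ℕ := ⌈3 * 2 ^ (k + 2) * R₁ / ε⌉₊ + 1 with hLdef
  have hL1 : 1 ≤ L := by omega
  have hLge : 3 * 2 ^ (k + 2) * R₁ / ε ≤ L := by
    rw [hLdef]
    push_cast
    linarith [Nat.le_ceil (3 * 2 ^ (k + 2) * R₁ / ε)]
  set Cmax : ℝ := 2 ^ (k + 1) * ∑ m ∈ Finset.range (K + 1), (1 + dualMomentBound k (2 * m) A 1)
    with hCmax
  have hterms : ∀ m, 0 ≤ 1 + dualMomentBound k (2 * m) A 1 := fun m => by
    linarith [dualMomentBound_nonneg k (2 * m) A zero_le_one]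
  have hCmaxpos : 0 < Cmax := by
    rw [hCmax]
    refine mul_pos (by positivity) (Finset.sum_pos' (fun m _ => hterms m) ⟨0, by simp, ?_⟩)
    linarith [dualMomentBound_nonneg k (2 * 0) A zero_le_one]
  set η₀ : ℝ := min (min 1 ε') ((ε' / Cmax) ^ (2 ^ k)) with hη₀
  have hη₀pos : 0 < η₀ := lt_min (lt_min one_pos hε') (by positivity)
  refine ⟨η₀, hη₀pos, (min_le_left _ _).trans (min_le_left _ _), ?_⟩
  intro M _ D₀ h2k hk1 η ν hη0 hηle hPR Gψ θ hGψ hθ0 hθC hψ0 hψ1 f hf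
  obtain ⟨hν0, hLFC, hCC⟩ := hPR
  have hη1 : η ≤ 1 := hηle.trans ((min_le_left _ _).trans (min_le_left _ _))
  have hηε' : η ≤ ε' := hηle.trans ((min_le_left _ _).trans (min_le_right _ _))
  have hηC : η ≤ (ε' / Cmax) ^ (2 ^ k) := hηle.trans (min_le_right _ _)
  have hD1 : 1 ≤ D₀ := le_trans (by omega) hk1
  -- consequences of the linear forms condition
  have hE : (𝔼 x, ν x) ≤ 1 + η := expect_le_of_linearFormsCondition hLFC hD1
  have hEabs : |(𝔼 x, ν x) - 1| ≤ η := abs_expect_sub_one_le_of_linearFormsCondition hLFC hD1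
  have hRbd : ∀ G : Finset (Fin k) → ZMod M → ℝ, (∀ ω x, |G ω x| ≤ ν x + 1) →
      ∀ x, |gdual k G x| ≤ R₁ := by
    intro G hG x
    refine (abs_gdual_le hLFC hη0 hk h2k G hG x).trans ?_
    calc (2 : ℝ) ^ (2 ^ k - 1) * (1 + η) ≤ 2 ^ (2 ^ k - 1) * 2 := by gcongr; linarith
      _ = R₁ := by rw [hR₁, ← pow_succ, Nat.sub_add_cancel Nat.one_le_two_pow]
  have hGψ' : ∀ ω x, |Gψ ω x| ≤ ν x + 1 := fun ω x => (hGψ ω x).trans (by linarith [hν0 x])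
  -- `‖ν - 1‖_{U^k} ≤ 2 η^{1/2^k}`
  have hU : gowersPower k (fun x => ν x - 1) ^ e ≤ 2 * η ^ e := by
    have h1 := abs_gowersPower_sub_one_le hLFC hη0 h2k hk1 hD1
    have h2 : gowersPower k (fun x => ν x - 1) ≤ 2 ^ 2 ^ k * η := (le_abs_self _).trans h1
    calc gowersPower k (fun x => ν x - 1) ^ e ≤ ((2 : ℝ) ^ 2 ^ k * η) ^ e :=
          Real.rpow_le_rpow (gowersPower_nonneg hk _) h2 he0
      _ = ((2 : ℝ) ^ 2 ^ k) ^ e * η ^ e := Real.mul_rpow (by positivity) hη0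
      _ = 2 * η ^ e := by
          congr 1
          rw [hedef, show ((2 : ℝ) ^ 2 ^ k) = 2 ^ (((2 ^ k : ℕ) : ℝ)) by norm_cast,
            ← Real.rpow_mul (by norm_num), mul_inv_cancel₀ (by positivity), Real.rpow_one]
  have hηe : η ^ e ≤ ε' / Cmax := by
    have h1 := Real.rpow_le_rpow hη0 hηC he0
    rwa [hedef, Real.pow_rpow_inv_natCast (by positivity : (0 : ℝ) ≤ ε' / Cmax) (by positivity)]
      at h1
  -- the finite family of test functions
  set φ : (Finset (Fin k) → ZMod M → Fin (L + 1)) → ZMod M → ℝ :=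
    fun c x => gdual k Gψ x * gdual k (gridDecode ν L c) x / R₁ ^ 2 with hφdef
  have hφ : ∀ c x, |φ c x| ≤ 1 := by
    intro c x
    rw [hφdef]
    dsimp only
    rw [abs_div, abs_mul, abs_of_pos (by positivity : (0 : ℝ) < R₁ ^ 2), div_le_one (by positivity),
      sq]
    exact mul_le_mul (hRbd Gψ hGψ' x) (hRbd _ (abs_gridDecode_le hν0 hL1 c) x) (abs_nonneg _)
      (by positivity)
  -- pseudorandomness of `ν` against products of at most `K` test functions
  have hPRφ : ∀ m ≤ K, ∀ a : Fin m → (Finset (Fin k) → ZMod M → Fin (L + 1)),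
      |𝔼 x, (ν x - 1) * ∏ i, φ (a i) x| ≤ ε' := by
    intro m hm a
    rcases Nat.eq_zero_or_pos m with rfl | hmpos
    · simp only [Finset.univ_eq_empty, Finset.prod_empty, mul_one]
      rw [Finset.expect_sub_distrib, Fintype.expect_const]
      exact hEabs.trans hηε'
    · -- the product of the `2m` dual functions
      set GG : Fin m ⊕ Fin m → Finset (Fin k) → ZMod M → ℝ :=
        Sum.elim (fun _ => Gψ) (fun i => gridDecode ν L (a i)) with hGG
      have hGGbd : ∀ j ω x, |GG j ω x| ≤ ν x + 1 := by
        rintro (i | i) ω x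
        · exact hGψ' ω x
        · exact abs_gridDecode_le hν0 hL1 (a i) ω x
      have hprod : ∀ x, ∏ i, φ (a i) x = (∏ j, gdual k (GG j) x) / (R₁ ^ 2) ^ m := by
        intro x
        rw [Fintype.prod_sum_type]
        simp only [hGG, Sum.elim_inl, Sum.elim_inr, hφdef]
        rw [Finset.prod_div_distrib, Finset.prod_const, Finset.card_univ, Fintype.card_fin,
          Finset.prod_mul_distrib]
      simp_rw [hprod]
      have hcard : Fintype.card (Fin m ⊕ Fin m) = 2 * m := by
        rw [Fintype.card_sum, Fintype.card_fin]; ring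
      have hmain := abs_expect_sub_one_mul_prod_gdual_le hν0 hCC hE hη0 hk h2k
        (ι := Fin m ⊕ Fin m) (by rw [hcard]; omega) GG hGGbd
      rw [hcard] at hmain
      have hdiv : ∀ x, (ν x - 1) * ((∏ j, gdual k (GG j) x) / (R₁ ^ 2) ^ m) =
          ((ν x - 1) * ∏ j, gdual k (GG j) x) / (R₁ ^ 2) ^ m := fun x => by ring
      simp_rw [hdiv]
      rw [← Finset.expect_div, abs_div, abs_of_pos (by positivity : (0 : ℝ) < (R₁ ^ 2) ^ m)]
      refine (div_le_self (abs_nonneg _) (one_le_pow₀ (one_le_pow₀ hR₁1))).trans ?_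
      refine hmain.trans ?_
      -- `‖ν-1‖ (2^k - 1)(1 + T) ≤ 2 η^{1/2^k} 2^k (1 + T(η := 1)) ≤ Cmax η^{1/2^k} ≤ ε'`
      have hT : dualMomentBound k (2 * m) A η ≤ dualMomentBound k (2 * m) A 1 :=
        dualMomentBound_mono k (2 * m) A (by linarith) hη1
      have hT0 : 0 ≤ dualMomentBound k (2 * m) A η := dualMomentBound_nonneg k _ A hη0
      have h2k1 : ((2 ^ k - 1 : ℕ) : ℝ) ≤ 2 ^ k := by
        exact_mod_cast Nat.sub_le _ _
      have hmem : m ∈ Finset.range (K + 1) := Finset.mem_range.mpr (by omega)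
      have hsingle : 1 + dualMomentBound k (2 * m) A 1 ≤
          ∑ m' ∈ Finset.range (K + 1), (1 + dualMomentBound k (2 * m') A 1) :=
        Finset.single_le_sum (f := fun m' => 1 + dualMomentBound k (2 * m') A 1)
          (fun m' _ => hterms m') hmem
      have hgp0 : 0 ≤ gowersPower k (fun x => ν x - 1) ^ e := Real.rpow_nonneg (gowersPower_nonneg hk _) _
      calc gowersPower k (fun x => ν x - 1) ^ e * (((2 ^ k - 1 : ℕ) : ℝ) * (1 + dualMomentBound k (2 * m) A η))
          ≤ (2 * η ^ e) * ((2 : ℝ) ^ k * (1 + dualMomentBound k (2 * m) A 1)) := by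
            refine mul_le_mul hU ?_ (by positivity) (by positivity)
            exact mul_le_mul h2k1 (by linarith) (by positivity) (by positivity)
        _ = η ^ e * (2 ^ (k + 1) * (1 + dualMomentBound k (2 * m) A 1)) := by ring
        _ ≤ η ^ e * Cmax := by
            refine mul_le_mul_of_nonneg_left ?_ (Real.rpow_nonneg hη0 _)
            rw [hCmax]
            exact mul_le_mul_of_nonneg_left hsingle (by positivity)
        _ ≤ ε' / Cmax * Cmax := mul_le_mul_of_nonneg_right hηe hCmaxpos.le
        _ = ε' := div_mul_cancel₀ ε' hCmaxpos.ne'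
  -- apply the abstract dense model theorem
  obtain ⟨g, hg1, hfg, hsmall⟩ := HDM (ZMod M) (Finset (Fin k) → ZMod M → Fin (L + 1)) φ hφ ν hν0
    hPRφ f hf
  refine ⟨g, hg1, hfg, ?_⟩
  -- `‖hψ‖_{U^k}^{2^k} = ⟨hψ, 𝒟(hψ)⟩ = ⟨hψ, 𝒟G_r⟩ + ⟨hψ, 𝒟(hψ) - 𝒟G_r⟩`
  set ψ : ZMod M → ℝ := fun x => θ * gdual k Gψ x with hψdef
  set hψ : ZMod M → ℝ := fun x => (f x - g x) * ψ x with hhψ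
  have hhψbd : ∀ x, |hψ x| ≤ ν x + 1 := by
    intro x
    rw [hhψ]; dsimp only
    rw [abs_mul, abs_of_nonneg (hψ0 x)]
    exact (mul_le_of_le_one_right (abs_nonneg _) (hψ1 x)).trans (hfg x)
  set Gc : Finset (Fin k) → ZMod M → ℝ := fun _ y => hψ y with hGc
  have hGcbd : ∀ ω x, |Gc ω x| ≤ ν x + 1 := fun _ x => hhψbd x
  set c := gridRound ν L Gc with hc
  set Gr := gridDecode ν L c with hGr
  have hGrbd : ∀ ω x, |Gr ω x| ≤ ν x + 1 := abs_gridDecode_le hν0 hL1 c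
  have hround : ∀ ω x, |Gc ω x - Gr ω x| ≤ 2 / L * (ν x + 1) := by
    intro ω x
    rw [abs_sub_comm]
    exact abs_gridDecode_gridRound_sub_le hν0 hL1 hGcbd ω x
  have hdiff : ∀ x, |gdual k Gc x - gdual k Gr x| ≤ (2 ^ k - 1 : ℕ) * (2 / L) * R₁ := by
    intro x
    refine (abs_gdual_sub_gdual_le ν Gc Gr (by positivity) hGcbd hGrbd hround x).trans ?_
    refine mul_le_mul_of_nonneg_left ?_ (by positivity)
    have h1 := hRbd (fun _ y => ν y + 1) (fun _ y => by rw [abs_of_nonneg (by linarith [hν0 y])]) x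
    exact (le_abs_self _).trans h1
  show gowersPower k hψ ≤ ε
  rw [gowersPower_eq_expect_mul_gdual]
  have hkey : ∀ x, θ * R₁ ^ 2 * ((f x - g x) * φ c x) = hψ x * gdual k Gr x := by
    intro x
    rw [hφdef, hGr, hhψ, hψdef]
    dsimp only
    field_simp
  have hsplit : (𝔼 x, hψ x * gdual k (fun _ => hψ) x) =
      θ * R₁ ^ 2 * (𝔼 x, (f x - g x) * φ c x) +
        𝔼 x, hψ x * (gdual k Gc x - gdual k Gr x) := by
    rw [Finset.mul_expect, ← Finset.expect_add_distrib]
    refine Finset.expect_congr rfl fun x _ => ?_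
    rw [hkey x]
    show hψ x * gdual k Gc x = _
    ring
  rw [hsplit]
  have h1 : |θ * R₁ ^ 2 * (𝔼 x, (f x - g x) * φ c x)| ≤ ε / 2 := by
    rw [abs_mul, abs_of_nonneg (by positivity : (0 : ℝ) ≤ θ * R₁ ^ 2)]
    calc θ * R₁ ^ 2 * |𝔼 x, (f x - g x) * φ c x| ≤ C₀ * R₁ ^ 2 * ε₁ :=
          mul_le_mul (mul_le_mul_of_nonneg_right hθC (by positivity)) (hsmall c) (abs_nonneg _)
            (by positivity)
      _ = ε / 2 := by rw [hε₁]; field_simp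
  have h2 : |𝔼 x, hψ x * (gdual k Gc x - gdual k Gr x)| ≤ ε / 2 := by
    refine (Finset.abs_expect_le _ _).trans ?_
    have hpt : ∀ x, |hψ x * (gdual k Gc x - gdual k Gr x)| ≤
        (ν x + 1) * ((2 ^ k - 1 : ℕ) * (2 / L) * R₁) := fun x => by
      rw [abs_mul]
      exact mul_le_mul (hhψbd x) (hdiff x) (abs_nonneg _) (by linarith [hν0 x])
    refine (Finset.expect_le_expect fun x _ => hpt x).trans ?_
    rw [← Finset.expect_mul, Finset.expect_add_distrib, Fintype.expect_const]
    have hLpos : (0 : ℝ) < L := by exact_mod_cast hL1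
    have h2k1 : ((2 ^ k - 1 : ℕ) : ℝ) ≤ 2 ^ k := by exact_mod_cast Nat.sub_le _ _
    have hE3 : (𝔼 x, ν x) + 1 ≤ 3 := by linarith
    calc ((𝔼 x, ν x) + 1) * (((2 ^ k - 1 : ℕ) : ℝ) * (2 / L) * R₁)
        ≤ 3 * ((2 : ℝ) ^ k * (2 / L) * R₁) := by
          refine mul_le_mul hE3 ?_ (by positivity) (by norm_num)
          exact mul_le_mul_of_nonneg_right (mul_le_mul_of_nonneg_right h2k1 (by positivity))
            (by positivity)
      _ = (3 * 2 ^ (k + 2) * R₁ / ε) * (ε / 2) / L := by field_simp; ring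
      _ ≤ L * (ε / 2) / L := by gcongr
      _ = ε / 2 := by field_simp
  calc θ * R₁ ^ 2 * (𝔼 x, (f x - g x) * φ c x) + 𝔼 x, hψ x * (gdual k Gc x - gdual k Gr x)
      ≤ |θ * R₁ ^ 2 * (𝔼 x, (f x - g x) * φ c x)| + |𝔼 x, hψ x * (gdual k Gc x - gdual k Gr x)| :=
        add_le_add (le_abs_self _) (le_abs_self _)
    _ ≤ ε / 2 + ε / 2 := add_le_add h1 h2
    _ = ε := by ring

end densemodel

section taper

variable {M : ℕ} [NeZero M]

/-! ### The taper: a dual function equal to `1` on an interval and supported near it -/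

/-- The **taper family** attached to two distinct directions `i₁ ≠ i₂` and two sets `I, A ⊆ ℤ_M`:
`1_I` at the vertex `{i₁}`, `1_A` at `{i₂}` and at `{i₁, i₂}`, and `1` at every other vertex, so
that `𝒟T(x) = 𝔼_{h} 1_I(x + h_{i₁}) 1_A(x + h_{i₂}) 1_A(x + h_{i₁} + h_{i₂})` is (up to the factor
`(|A|/M)²`) a smoothed indicator of `I` (for `A` a short interval: the trapezoid `1_I ∗ μ_A ∗ μ_{-A}`
of App. C). [cite: GreenTao2010, §10 (proof of Prop. 10.3, the cutoff `ψ`) and App. C] -/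
def taperFamily {k : ℕ} (i₁ i₂ : Fin k) (I A : Finset (ZMod M)) (ω : Finset (Fin k))
    (x : ZMod M) : ℝ :=
  if ω = {i₁} then (if x ∈ I then 1 else 0)
  else if ω = {i₂} ∨ ω = {i₁, i₂} then (if x ∈ A then 1 else 0) else 1

/-- The **taper** `ψ = (M/|A|)² 𝒟T`. [cite: GreenTao2010, §10 (proof of Prop. 10.3, the cutoff `ψ`)] -/
def taper {k : ℕ} (i₁ i₂ : Fin k) (I A : Finset (ZMod M)) (x : ZMod M) : ℝ :=
  ((M : ℝ) / A.card) ^ 2 * gdual k (taperFamily i₁ i₂ I A) x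

omit [NeZero M] in
/-- The taper family takes values in `[0, 1]`. [folklore] -/
theorem taperFamily_mem {k : ℕ} (i₁ i₂ : Fin k) (I A : Finset (ZMod M)) (ω : Finset (Fin k))
    (x : ZMod M) : 0 ≤ taperFamily i₁ i₂ I A ω x ∧ taperFamily i₁ i₂ I A ω x ≤ 1 := by
  unfold taperFamily
  split_ifs <;> norm_num

omit [NeZero M] in
/-- The taper family is `1`-bounded. [folklore] -/
theorem abs_taperFamily_le {k : ℕ} (i₁ i₂ : Fin k) (I A : Finset (ZMod M)) (ω : Finset (Fin k))
    (x : ZMod M) : |taperFamily i₁ i₂ I A ω x| ≤ 1 := by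
  have h := taperFamily_mem i₁ i₂ I A ω x
  rw [abs_of_nonneg h.1]; exact h.2

omit [NeZero M] in
/-- The cube product of the taper family is in `[0, 1]` and is at most each of its factors.
[folklore] -/
theorem taper_prod_le_factor {k : ℕ} (i₁ i₂ : Fin k) (I A : Finset (ZMod M)) (x : ZMod M)
    (h : Fin k → ZMod M) {ω₀ : Finset (Fin k)}
    (hω₀ : ω₀ ∈ (Finset.univ : Finset (Finset (Fin k))).erase ∅) :
    0 ≤ ∏ ω ∈ (Finset.univ : Finset (Finset (Fin k))).erase ∅,
        taperFamily i₁ i₂ I A ω (x + ∑ j ∈ ω, h j) ∧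
      ∏ ω ∈ (Finset.univ : Finset (Finset (Fin k))).erase ∅,
          taperFamily i₁ i₂ I A ω (x + ∑ j ∈ ω, h j) ≤
        taperFamily i₁ i₂ I A ω₀ (x + ∑ j ∈ ω₀, h j) := by
  refine ⟨Finset.prod_nonneg fun ω _ => (taperFamily_mem i₁ i₂ I A ω _).1, ?_⟩
  rw [← Finset.mul_prod_erase _ _ hω₀]
  refine mul_le_of_le_one_right (taperFamily_mem i₁ i₂ I A ω₀ _).1 ?_
  exact Finset.prod_le_one (fun ω _ => (taperFamily_mem i₁ i₂ I A ω _).1)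
    fun ω _ => (taperFamily_mem i₁ i₂ I A ω _).2

/-- The average `𝔼_h 1_A(x + h_{i₂}) 1_A(x + h_{i₁} + h_{i₂}) = (|A|/M)²` for `i₁ ≠ i₂`. [folklore] -/
theorem expect_indicator_pair {k : ℕ} {i₁ i₂ : Fin k} (hne : i₁ ≠ i₂) (A : Finset (ZMod M))
    (x : ZMod M) :
    (𝔼 h : Fin k → ZMod M, (if x + h i₂ ∈ A then (1 : ℝ) else 0) *
        (if x + (h i₁ + h i₂) ∈ A then (1 : ℝ) else 0)) = ((A.card : ℝ) / M) ^ 2 := by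
  set ind : ZMod M → ℝ := fun y => if y ∈ A then 1 else 0 with hind_def
  have hind : ∀ c : ZMod M, (𝔼 u : ZMod M, ind (u + c)) = (A.card : ℝ) / M := by
    intro c
    rw [expect_add_right ind c, Finset.expect_eq_sum_div_card, Finset.card_univ, ZMod.card, hind_def]
    dsimp only
    rw [Finset.sum_boole, Finset.filter_mem_eq_inter, Finset.univ_inter]
  have step3 : (𝔼 h : Fin k → ZMod M, ind (x + h i₂)) = (A.card : ℝ) / M := by
    rw [← expect_expect_update i₂ (fun h : Fin k → ZMod M => ind (x + h i₂))]
    simp only [Function.update_self]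
    have : ∀ u : ZMod M, x + u = u + x := fun u => add_comm _ _
    simp_rw [this, hind x]
    exact Fintype.expect_const _
  show (𝔼 h : Fin k → ZMod M, ind (x + h i₂) * ind (x + (h i₁ + h i₂))) = ((A.card : ℝ) / M) ^ 2
  calc (𝔼 h : Fin k → ZMod M, ind (x + h i₂) * ind (x + (h i₁ + h i₂)))
      = 𝔼 h : Fin k → ZMod M, 𝔼 u : ZMod M, ind (x + h i₂) * ind (x + (u + h i₂)) := by
        rw [← expect_expect_update i₁
          (fun h : Fin k → ZMod M => ind (x + h i₂) * ind (x + (h i₁ + h i₂)))]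
        simp only [Function.update_self, Function.update_of_ne hne.symm]
    _ = 𝔼 h : Fin k → ZMod M, ind (x + h i₂) * ((A.card : ℝ) / M) := by
        refine Finset.expect_congr rfl fun h _ => ?_
        rw [← Finset.mul_expect]
        congr 1
        have : ∀ u : ZMod M, x + (u + h i₂) = u + (x + h i₂) := fun u => by abel
        simp_rw [this]
        exact hind _
    _ = ((A.card : ℝ) / M) * 𝔼 h : Fin k → ZMod M, ind (x + h i₂) := by
        rw [← Finset.expect_mul, mul_comm]
    _ = ((A.card : ℝ) / M) ^ 2 := by rw [step3, sq]

omit [NeZero M] in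
/-- Sufficient conditions for a factor of the taper family to be `1`. [folklore] -/
theorem taperFamily_eq_one_of {k : ℕ} {i₁ i₂ : Fin k} {I A : Finset (ZMod M)} {ω : Finset (Fin k)}
    {y : ZMod M} (h₁ : ω = {i₁} → y ∈ I) (h₂ : ω = {i₂} ∨ ω = {i₁, i₂} → y ∈ A) :
    taperFamily i₁ i₂ I A ω y = 1 := by
  unfold taperFamily
  by_cases hω : ω = {i₁}
  · rw [if_pos hω, if_pos (h₁ hω)]
  · rw [if_neg hω]
    by_cases hω' : ω = {i₂} ∨ ω = {i₁, i₂}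
    · rw [if_pos hω', if_pos (h₂ hω')]
    · rw [if_neg hω']

/-- The dual function of the taper family is between `0` and `(|A|/M)²`. [folklore] -/
theorem gdual_taperFamily_mem {k : ℕ} {i₁ i₂ : Fin k} (hne : i₁ ≠ i₂) (I A : Finset (ZMod M))
    (x : ZMod M) :
    0 ≤ gdual k (taperFamily i₁ i₂ I A) x ∧
      gdual k (taperFamily i₁ i₂ I A) x ≤ ((A.card : ℝ) / M) ^ 2 := by
  have hi₂ : ({i₂} : Finset (Fin k)) ∈ (Finset.univ : Finset (Finset (Fin k))).erase ∅ :=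
    Finset.mem_erase.mpr ⟨Finset.singleton_ne_empty _, Finset.mem_univ _⟩
  have hi₁₂ : ({i₁, i₂} : Finset (Fin k)) ∈ (Finset.univ : Finset (Finset (Fin k))).erase ∅ :=
    Finset.mem_erase.mpr ⟨(Finset.insert_nonempty _ _).ne_empty, Finset.mem_univ _⟩
  have hv₂ : ∀ y, taperFamily i₁ i₂ I A {i₂} y = if y ∈ A then 1 else 0 := by
    intro y
    unfold taperFamily
    rw [if_neg (fun h => hne (Finset.singleton_injective h).symm), if_pos (Or.inl rfl)]
  have hv₁₂ : ∀ y, taperFamily i₁ i₂ I A {i₁, i₂} y = if y ∈ A then 1 else 0 := by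
    intro y
    unfold taperFamily
    have hne' : ({i₁, i₂} : Finset (Fin k)) ≠ {i₁} := by
      intro h
      have : i₂ ∈ ({i₁} : Finset (Fin k)) := h ▸ Finset.mem_insert_of_mem (Finset.mem_singleton_self _)
      exact hne (Finset.mem_singleton.mp this).symm
    rw [if_neg hne', if_pos (Or.inr rfl)]
  unfold gdual
  refine ⟨Finset.expect_nonneg fun h _ => (taper_prod_le_factor i₁ i₂ I A x h hi₂).1, ?_⟩
  rw [← expect_indicator_pair hne A x]
  refine Finset.expect_le_expect fun h _ => ?_
  -- the product is at most the product of the two `A`-factors (all factors lie in `[0,1]`)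
  have hb₂ := (taper_prod_le_factor i₁ i₂ I A x h hi₂).2
  have hb₁₂ := (taper_prod_le_factor i₁ i₂ I A x h hi₁₂).2
  have h0 := (taper_prod_le_factor i₁ i₂ I A x h hi₂).1
  rw [hv₂, Finset.sum_singleton] at hb₂
  rw [hv₁₂, Finset.sum_pair hne] at hb₁₂
  by_cases hA₂ : x + h i₂ ∈ A
  · by_cases hA₁₂ : x + (h i₁ + h i₂) ∈ A
    · rw [if_pos hA₂, if_pos hA₁₂, mul_one]
      rw [if_pos hA₁₂] at hb₁₂
      exact hb₁₂
    · rw [if_neg hA₁₂] at hb₁₂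
      rw [if_pos hA₂, if_neg hA₁₂, mul_zero]
      exact hb₁₂
  · rw [if_neg hA₂] at hb₂
    rw [if_neg hA₂, zero_mul]
    exact hb₂

/-- **The taper lies in `[0, 1]`.** [cite: GreenTao2010, §10 (proof of Prop. 10.3: "`ψ : ℤ_{N'} → [0,1]`")] -/
theorem taper_mem {k : ℕ} {i₁ i₂ : Fin k} (hne : i₁ ≠ i₂) (I A : Finset (ZMod M)) (x : ZMod M) :
    0 ≤ taper i₁ i₂ I A x ∧ taper i₁ i₂ I A x ≤ 1 := by
  unfold taper
  have h := gdual_taperFamily_mem hne I A x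
  refine ⟨mul_nonneg (sq_nonneg _) h.1, ?_⟩
  rcases Nat.eq_zero_or_pos A.card with hA | hA
  · rw [hA]; simp
  · have hM : (0 : ℝ) < M := by exact_mod_cast Nat.pos_of_ne_zero (NeZero.ne M)
    have hA' : (0 : ℝ) < A.card := by exact_mod_cast hA
    calc ((M : ℝ) / A.card) ^ 2 * gdual k (taperFamily i₁ i₂ I A) x
        ≤ ((M : ℝ) / A.card) ^ 2 * ((A.card : ℝ) / M) ^ 2 :=
          mul_le_mul_of_nonneg_left h.2 (sq_nonneg _)
      _ = 1 := by field_simp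

/-- **The taper is `1` where `x + (A - A) ⊆ I`.** [cite: GreenTao2010, §10 (proof of Prop. 10.3:
"`ψ` … equals `1` on `{-N, …, N}`")] -/
theorem taper_eq_one {k : ℕ} {i₁ i₂ : Fin k} (hne : i₁ ≠ i₂) {I A : Finset (ZMod M)}
    (hA : 0 < A.card) {x : ZMod M} (hx : ∀ a ∈ A, ∀ b ∈ A, x + (b - a) ∈ I) :
    taper i₁ i₂ I A x = 1 := by
  have hM : (0 : ℝ) < M := by exact_mod_cast Nat.pos_of_ne_zero (NeZero.ne M)
  have hA' : (0 : ℝ) < A.card := by exact_mod_cast hA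
  suffices hge : ((A.card : ℝ) / M) ^ 2 ≤ gdual k (taperFamily i₁ i₂ I A) x by
    have hle := (gdual_taperFamily_mem hne I A x).2
    have heq : gdual k (taperFamily i₁ i₂ I A) x = ((A.card : ℝ) / M) ^ 2 := le_antisymm hle hge
    unfold taper
    rw [heq]
    field_simp
  rw [← expect_indicator_pair hne A x]
  unfold gdual
  refine Finset.expect_le_expect fun h _ => ?_
  by_cases hA₂ : x + h i₂ ∈ A
  · by_cases hA₁₂ : x + (h i₁ + h i₂) ∈ A
    · -- all factors equal `1`
      rw [if_pos hA₂, if_pos hA₁₂, mul_one]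
      refine le_of_eq (Finset.prod_eq_one fun ω _ => ?_).symm
      refine taperFamily_eq_one_of (fun hω => ?_) (fun hω => ?_)
      · subst hω
        rw [Finset.sum_singleton]
        have := hx _ hA₂ _ hA₁₂
        rwa [show x + (x + (h i₁ + h i₂) - (x + h i₂)) = x + h i₁ by abel] at this
      · rcases hω with rfl | rfl
        · rwa [Finset.sum_singleton]
        · rwa [Finset.sum_pair hne]
    · rw [if_pos hA₂, if_neg hA₁₂, mul_zero]
      exact Finset.prod_nonneg fun ω _ => (taperFamily_mem i₁ i₂ I A ω _).1
  · rw [if_neg hA₂, zero_mul]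
    exact Finset.prod_nonneg fun ω _ => (taperFamily_mem i₁ i₂ I A ω _).1

/-- **The taper vanishes where `x + (A - A)` misses `I`.** [cite: GreenTao2010, §10 (proof of
Prop. 10.3: "`ψ` … vanishes outside of `{-2N, …, 2N}`")] -/
theorem taper_eq_zero {k : ℕ} {i₁ i₂ : Fin k} (hne : i₁ ≠ i₂) {I A : Finset (ZMod M)} {x : ZMod M}
    (hx : ∀ a ∈ A, ∀ b ∈ A, x + (b - a) ∉ I) : taper i₁ i₂ I A x = 0 := by
  unfold taper
  suffices h0 : gdual k (taperFamily i₁ i₂ I A) x = 0 by rw [h0, mul_zero]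
  refine le_antisymm ?_ (gdual_taperFamily_mem hne I A x).1
  unfold gdual
  refine (Finset.expect_le_expect (g := fun _ => (0 : ℝ)) fun h _ => ?_).trans
    (le_of_eq (Fintype.expect_const _))
  have hi₁ : ({i₁} : Finset (Fin k)) ∈ (Finset.univ : Finset (Finset (Fin k))).erase ∅ :=
    Finset.mem_erase.mpr ⟨Finset.singleton_ne_empty _, Finset.mem_univ _⟩
  have hi₂ : ({i₂} : Finset (Fin k)) ∈ (Finset.univ : Finset (Finset (Fin k))).erase ∅ :=
    Finset.mem_erase.mpr ⟨Finset.singleton_ne_empty _, Finset.mem_univ _⟩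
  have hi₁₂ : ({i₁, i₂} : Finset (Fin k)) ∈ (Finset.univ : Finset (Finset (Fin k))).erase ∅ :=
    Finset.mem_erase.mpr ⟨(Finset.insert_nonempty _ _).ne_empty, Finset.mem_univ _⟩
  have hb₁ := (taper_prod_le_factor i₁ i₂ I A x h hi₁).2
  have hb₂ := (taper_prod_le_factor i₁ i₂ I A x h hi₂).2
  have hb₁₂ := (taper_prod_le_factor i₁ i₂ I A x h hi₁₂).2
  have hne₁₂ : ({i₁, i₂} : Finset (Fin k)) ≠ {i₁} := by
    intro h'
    have : i₂ ∈ ({i₁} : Finset (Fin k)) := h' ▸ Finset.mem_insert_of_mem (Finset.mem_singleton_self _)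
    exact hne (Finset.mem_singleton.mp this).symm
  have hne₂₁ : ({i₂} : Finset (Fin k)) ≠ {i₁} := fun h' => hne (Finset.singleton_injective h').symm
  simp only [taperFamily, if_true, Finset.sum_singleton] at hb₁
  simp only [taperFamily, if_neg hne₂₁, true_or, if_true, Finset.sum_singleton] at hb₂
  simp only [taperFamily, if_neg hne₁₂, or_true, if_true, Finset.sum_pair hne] at hb₁₂
  by_cases hA₂ : x + h i₂ ∈ A
  · by_cases hA₁₂ : x + (h i₁ + h i₂) ∈ A
    · have := hx _ hA₂ _ hA₁₂
      rw [show x + (x + (h i₁ + h i₂) - (x + h i₂)) = x + h i₁ by abel] at this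
      rw [if_neg this] at hb₁
      exact hb₁
    · rw [if_neg hA₁₂] at hb₁₂
      exact hb₁₂
  · rw [if_neg hA₂] at hb₂
    exact hb₂

/-- The taper is supported where `x + (A - A)` meets `I`. [folklore] -/
theorem exists_of_taper_ne_zero {k : ℕ} {i₁ i₂ : Fin k} (hne : i₁ ≠ i₂) {I A : Finset (ZMod M)}
    {x : ZMod M} (hx : taper i₁ i₂ I A x ≠ 0) : ∃ a ∈ A, ∃ b ∈ A, x + (b - a) ∈ I := by
  by_contra hall
  push Not at hall
  exact hx (taper_eq_zero hne hall)

end taper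

end Literature.NumberTheory.Sieve
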